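import Summits.AtomisticToContinuum.Crystallization.Theorems.FrustratedLawDichotomyLinearImages
import Literature.MathematicalPhysics.StatisticalMechanics.MuGSC

/-!
# FrustratedLawDichotomy · crux `AperiodicFrustratedLawGap` (stmt-AtomisticToContinuum-27623) — THE VIRIAL IDENTITY OF MINIMISING LAWS
# (decomp-a2c, prover hand 2, structural share, generation 2)

A new SETTLED NECESSARY CONDITION on counterexamples to the crux, by the dilation family.  For a rooted `δ`-hard-core configuration
`μ = count|S` write `I₆(μ) = Σ_{0 ≠ y ∈ S} ‖y‖⁻⁶` and `I₁₂(μ) = Σ_{0 ≠ y ∈ S} ‖y‖⁻¹²` (as `∫⁻ ofReal`, finite by the shell bound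
`Σ ‖y‖⁻⁶ ≤ 250 δ⁻⁶`).  Since `V_LJ(c r) = (1/12) c⁻¹² r⁻¹² − (1/6) c⁻⁶ r⁻⁶`, the dilated law `P_c = P ∘ (μ ↦ (c•)_*μ)⁻¹` has mean root energy
`g(c) = (1/24) c⁻¹² E_P[I₁₂] − (1/12) c⁻⁶ E_P[I₆]` (`integral_dilatedEnergy`), and it is a point-stationary `c δ`-hard-core probability law, so
the floor of item 9229 gives `e⋆ ≤ g(c)` for every `c > 0` (`FrustratedLawDichotomyLinearImages.eStar_le_integral_dilated`).  If `P` is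
minimising (`E_P[rootEnergy] = g(1) ≤ e⋆`) then `c = 1` is a minimum of `g` on `(0, ∞)` and Fermat's rule (`IsLocalMin.hasDerivAt_eq_zero`)
gives `g'(1) = −½ E_P[I₁₂] + ½ E_P[I₆] = 0`:

* `virial_of_minimising` — **VIRIAL IDENTITY**: granted the floor, every point-stationary `δ`-hard-core probability law with
  `E_P[rootEnergy] ≤ e⋆` has `E_P[I₆] = E_P[I₁₂]`, `E_P[rootEnergy] = −(1/24) E_P[I₁₂]` and `E_P[rootEnergy] = e⋆`;
* `virial_of_minimising'` — the same with Bochner moments `∫∫ ‖y‖⁻⁶ dμ dP = ∫∫ ‖y‖⁻¹² dμ dP` (the form used in the cut of the crux).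

In words: an exact Lennard-Jones minimiser among stationary laws has ZERO PALM PRESSURE, `⟨Σ r⁻⁶⟩ = ⟨Σ r⁻¹²⟩ = −24 e⋆` — the law-level twin of
the optimal-dilation identity for periodic minimisers.  The cut of the crux by this condition is `FrustratedLawDichotomyAperiodicGapVirialCut`.
All `[folklore]`.
-/

noncomputable section

namespace Summit.AtomisticToContinuum.Crystallization.Theorems.FrustratedLawDichotomyVirial

open MeasureTheory Metric Set Filter
open scoped ENNReal Topology BigOperators
open Literature.MathematicalPhysics.StatisticalMechanics Literature.Probability.Process
open Summit.AtomisticToContinuum.Crystallization.Theorems.ChargedEnergyGapNegative (E3 eStar)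
open Literature.Probability.Process.LocalConfig (finite_inter_of_separated)
open Summit.AtomisticToContinuum.Crystallization.Theorems.FrustratedLawDichotomyLinearImages (eStar_le_integral_dilated)

/-! ## §1. Inverse-power shell moments of a rooted hard-core configuration -/

section Moments

variable {δ : ℝ} {S : Set E3}

/-- The fields `y ↦ (‖y‖⁻ᵏ)⁺` (as `ℝ≥0∞`) are measurable. [folklore] -/
theorem measurable_ofReal_invPow (k : ℕ) : Measurable fun y : E3 => ENNReal.ofReal (‖y‖⁻¹ ^ k) :=
  ENNReal.measurable_ofReal.comp ((measurable_norm.inv).pow_const k)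

/-- Finite shell sums from the root: `Σ_{z ∈ T, z ≠ 0} ‖z‖⁻⁶ ≤ 250 δ⁻⁶` and `Σ_{z ∈ T, z ≠ 0} ‖z‖⁻¹² ≤ 250 δ⁻⁶·δ⁻⁶` for a finite `δ`-separated
`T ∋ 0`. [folklore] -/
theorem sum_erase_invPow_le (hδ : 0 < δ) (T : Finset E3) (hsep : ∀ x ∈ T, ∀ z ∈ T, x ≠ z → δ ≤ dist x z) (h0 : (0 : E3) ∈ T) :
    ∑ z ∈ T.erase 0, ‖z‖⁻¹ ^ 6 ≤ 250 * δ⁻¹ ^ 6 ∧ ∑ z ∈ T.erase 0, ‖z‖⁻¹ ^ 12 ≤ 250 * δ⁻¹ ^ 6 * δ⁻¹ ^ 6 := by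
  have h6 : ∑ z ∈ T.erase 0, ‖z‖⁻¹ ^ 6 ≤ 250 * δ⁻¹ ^ 6 := by
    have h := sum_inv_pow_six_le_of_le_dist (T.erase 0) 0 hδ
      (fun z hz => hsep 0 h0 z (Finset.mem_of_mem_erase hz) (Finset.ne_of_mem_erase hz).symm)
      (fun z hz w hw hzw => hsep z (Finset.mem_of_mem_erase hz) w (Finset.mem_of_mem_erase hw) hzw)
    refine le_trans (le_of_eq (Finset.sum_congr rfl fun z _ => ?_)) h
    rw [dist_comm, dist_zero_right]
  refine ⟨h6, ?_⟩
  calc ∑ z ∈ T.erase 0, ‖z‖⁻¹ ^ 12 ≤ ∑ z ∈ T.erase 0, δ⁻¹ ^ 6 * ‖z‖⁻¹ ^ 6 := Finset.sum_le_sum fun z hz => by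
        have hz0 : z ≠ 0 := Finset.ne_of_mem_erase hz
        have hzd : δ ≤ ‖z‖ := by
          have h := hsep z (Finset.mem_of_mem_erase hz) 0 h0 hz0
          rwa [dist_zero_right] at h
        have h1 : ‖z‖⁻¹ ≤ δ⁻¹ := (inv_le_inv₀ (hδ.trans_le hzd) hδ).2 hzd
        have h2 : 0 ≤ ‖z‖⁻¹ := inv_nonneg.2 (norm_nonneg _)
        have h3 : ‖z‖⁻¹ ^ 6 ≤ δ⁻¹ ^ 6 := pow_le_pow_left₀ h2 h1 6
        have h4 : 0 ≤ ‖z‖⁻¹ ^ 6 := pow_nonneg h2 6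
        calc ‖z‖⁻¹ ^ 12 = ‖z‖⁻¹ ^ 6 * ‖z‖⁻¹ ^ 6 := by ring
          _ ≤ δ⁻¹ ^ 6 * ‖z‖⁻¹ ^ 6 := mul_le_mul_of_nonneg_right h3 h4
    _ = δ⁻¹ ^ 6 * ∑ z ∈ T.erase 0, ‖z‖⁻¹ ^ 6 := (Finset.mul_sum _ _ _).symm
    _ ≤ δ⁻¹ ^ 6 * (250 * δ⁻¹ ^ 6) := mul_le_mul_of_nonneg_left h6 (by positivity)
    _ = 250 * δ⁻¹ ^ 6 * δ⁻¹ ^ 6 := by ring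

/-- **Shell moment bounds**: for a `δ`-separated `S ∋ 0`, `Σ_{y ∈ S} ‖y‖⁻⁶ ≤ 250 δ⁻⁶` and `Σ_{y ∈ S} ‖y‖⁻¹² ≤ 250 δ⁻¹²` (the root contributes
`‖0‖⁻ᵏ = 0`). [folklore] -/
theorem lintegral_invPow_le (hδ : 0 < δ) (hsep : ∀ x ∈ S, ∀ y ∈ S, x ≠ y → δ ≤ dist x y) (h0 : (0 : E3) ∈ S) :
    ∫⁻ y, ENNReal.ofReal (‖y‖⁻¹ ^ 6) ∂((Measure.count : Measure E3).restrict S) ≤ ENNReal.ofReal (250 * δ⁻¹ ^ 6) ∧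
      ∫⁻ y, ENNReal.ofReal (‖y‖⁻¹ ^ 12) ∂((Measure.count : Measure E3).restrict S) ≤ ENNReal.ofReal (250 * δ⁻¹ ^ 6 * δ⁻¹ ^ 6) := by
  classical
  have hS : S.Countable := by
    have : S = ⋃ n : ℕ, closedBall (0 : E3) n ∩ S := by
      ext x
      simp only [mem_iUnion, mem_inter_iff, mem_closedBall, dist_zero_right]
      exact ⟨fun hx => ⟨⌈‖x‖⌉₊, Nat.le_ceil _, hx⟩, fun ⟨n, _, hx⟩ => hx⟩
    rw [this]
    exact countable_iUnion fun n => (finite_inter_of_separated hδ hsep (isCompact_closedBall (0 : E3) n)).countable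
  have key : ∀ (k : ℕ) (C : ℝ), k ≠ 0 →
      (∀ T : Finset E3, (∀ z ∈ T, z ∈ S) → (0 : E3) ∈ T → ∑ z ∈ T.erase 0, ‖z‖⁻¹ ^ k ≤ C) →
      ∫⁻ y, ENNReal.ofReal (‖y‖⁻¹ ^ k) ∂((Measure.count : Measure E3).restrict S) ≤ ENNReal.ofReal C := by
    intro k C hk hT
    rw [lintegral_countable _ hS, ENNReal.tsum_eq_iSup_sum]
    refine iSup_le fun T' => ?_
    set T : Finset E3 := insert 0 (T'.map (Function.Embedding.subtype (· ∈ S))) with hTdef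
    have hTS : ∀ z ∈ T, z ∈ S := by
      intro z hz
      rcases Finset.mem_insert.1 hz with rfl | hz
      · exact h0
      · obtain ⟨w, -, rfl⟩ := Finset.mem_map.1 hz
        exact w.2
    have h0T : (0 : E3) ∈ T := Finset.mem_insert_self _ _
    calc ∑ z ∈ T', ENNReal.ofReal (‖(z : E3)‖⁻¹ ^ k) * (Measure.count : Measure E3) {(z : E3)}
        = ∑ z ∈ T', ENNReal.ofReal (‖(z : E3)‖⁻¹ ^ k) := Finset.sum_congr rfl fun z _ => by
          rw [Measure.count_singleton, mul_one]
      _ = ∑ z ∈ T'.map (Function.Embedding.subtype (· ∈ S)), ENNReal.ofReal (‖z‖⁻¹ ^ k) := by rw [Finset.sum_map]; rfl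
      _ ≤ ∑ z ∈ T, ENNReal.ofReal (‖z‖⁻¹ ^ k) := Finset.sum_le_sum_of_subset (Finset.subset_insert _ _)
      _ = ∑ z ∈ T.erase 0, ENNReal.ofReal (‖z‖⁻¹ ^ k) := by
          rw [← Finset.add_sum_erase T _ h0T, norm_zero, inv_zero, zero_pow hk, ENNReal.ofReal_zero, zero_add]
      _ = ENNReal.ofReal (∑ z ∈ T.erase 0, ‖z‖⁻¹ ^ k) := (ENNReal.ofReal_sum_of_nonneg fun z _ => by positivity).symm
      _ ≤ ENNReal.ofReal C := ENNReal.ofReal_le_ofReal (hT T hTS h0T)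
  refine ⟨key 6 _ (by norm_num) fun T hTS h0T => ?_, key 12 _ (by norm_num) fun T hTS h0T => ?_⟩
  · exact (sum_erase_invPow_le hδ T (fun x hx z hz hxz => hsep x (hTS x hx) z (hTS z hz) hxz) h0T).1
  · exact (sum_erase_invPow_le hδ T (fun x hx z hz hxz => hsep x (hTS x hx) z (hTS z hz) hxz) h0T).2

variable {μ : Measure E3}

/-- The shell moments of a rooted `δ`-hard-core configuration are finite (`≤ 250 δ⁻⁶`, `≤ 250 δ⁻¹²`). [folklore] -/
theorem lintegral_invPow_le_of_isRootedHardCore (hδ : 0 < δ) (hμ : IsRootedHardCore δ μ) :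
    ∫⁻ y, ENNReal.ofReal (‖y‖⁻¹ ^ 6) ∂μ ≤ ENNReal.ofReal (250 * δ⁻¹ ^ 6) ∧
      ∫⁻ y, ENNReal.ofReal (‖y‖⁻¹ ^ 12) ∂μ ≤ ENNReal.ofReal (250 * δ⁻¹ ^ 6 * δ⁻¹ ^ 6) := by
  obtain ⟨S, h0, hsep, rfl⟩ := hμ
  exact lintegral_invPow_le hδ hsep h0

/-- The inverse-power fields are integrable against a rooted hard-core configuration. [folklore] -/
theorem integrable_invPow (hδ : 0 < δ) (hμ : IsRootedHardCore δ μ) :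
    Integrable (fun y : E3 => ‖y‖⁻¹ ^ 6) μ ∧ Integrable (fun y : E3 => ‖y‖⁻¹ ^ 12) μ := by
  obtain ⟨h6, h12⟩ := lintegral_invPow_le_of_isRootedHardCore hδ hμ
  have hfin : ∀ k : ℕ, ∫⁻ y, ENNReal.ofReal (‖y‖⁻¹ ^ k) ∂μ < ∞ → Integrable (fun y : E3 => ‖y‖⁻¹ ^ k) μ := by
    intro k hk
    refine ⟨((measurable_norm.inv).pow_const k).aestronglyMeasurable, ?_⟩
    show ∫⁻ y, ‖‖y‖⁻¹ ^ k‖ₑ ∂μ < ∞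
    refine lt_of_le_of_lt (le_of_eq (lintegral_congr fun y => ?_)) hk
    exact Real.enorm_eq_ofReal (by positivity)
  exact ⟨hfin 6 (h6.trans_lt ENNReal.ofReal_lt_top), hfin 12 (h12.trans_lt ENNReal.ofReal_lt_top)⟩

/-- Bochner moments are the real parts of the `ℝ≥0∞` moments. [folklore] -/
theorem integral_invPow_eq_toReal (hδ : 0 < δ) (hμ : IsRootedHardCore δ μ) :
    ∫ y, ‖y‖⁻¹ ^ 6 ∂μ = (∫⁻ y, ENNReal.ofReal (‖y‖⁻¹ ^ 6) ∂μ).toReal ∧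
      ∫ y, ‖y‖⁻¹ ^ 12 ∂μ = (∫⁻ y, ENNReal.ofReal (‖y‖⁻¹ ^ 12) ∂μ).toReal := by
  obtain ⟨h6, h12⟩ := integrable_invPow hδ hμ
  exact ⟨integral_eq_lintegral_of_nonneg_ae (Eventually.of_forall fun y => by positivity) h6.aestronglyMeasurable,
    integral_eq_lintegral_of_nonneg_ae (Eventually.of_forall fun y => by positivity) h12.aestronglyMeasurable⟩

end Moments

/-! ## §2. The dilated Lennard-Jones sum of a configuration -/

section Dilated

variable {δ : ℝ} {μ : Measure E3}

/-- `V_LJ(c r) = (1/12) c⁻¹² r⁻¹² − (1/6) c⁻⁶ r⁻⁶`. [folklore] -/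
theorem lennardJones_mul (c r : ℝ) : lennardJones (c * r) = 1 / 12 * c⁻¹ ^ 12 * r⁻¹ ^ 12 - 1 / 6 * c⁻¹ ^ 6 * r⁻¹ ^ 6 := by
  unfold lennardJones
  rw [mul_inv, mul_pow, mul_pow]
  ring

/-- **The dilated root sum splits by shell moments**: for a rooted `δ`-hard-core `μ` and any `c`,
`Σ_y V_LJ(c ‖y‖) = (1/12) c⁻¹² I₁₂(μ) − (1/6) c⁻⁶ I₆(μ)`. [folklore] -/
theorem integral_lennardJones_dilate (hδ : 0 < δ) (hμ : IsRootedHardCore δ μ) (c : ℝ) :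
    ∫ y, lennardJones (c * ‖y‖) ∂μ = 1 / 12 * c⁻¹ ^ 12 * (∫⁻ y, ENNReal.ofReal (‖y‖⁻¹ ^ 12) ∂μ).toReal -
      1 / 6 * c⁻¹ ^ 6 * (∫⁻ y, ENNReal.ofReal (‖y‖⁻¹ ^ 6) ∂μ).toReal := by
  obtain ⟨hi6, hi12⟩ := integrable_invPow hδ hμ
  obtain ⟨he6, he12⟩ := integral_invPow_eq_toReal hδ hμ
  simp_rw [lennardJones_mul]
  rw [integral_sub (hi12.const_mul _) (hi6.const_mul _), integral_const_mul, integral_const_mul, he6, he12]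

/-- The undilated case: `Σ_y V_LJ(‖y‖) = (1/12) I₁₂(μ) − (1/6) I₆(μ)`, i.e. `rootEnergy V_LJ μ = (1/24) I₁₂(μ) − (1/12) I₆(μ)`. [folklore] -/
theorem rootEnergy_eq_moments (hδ : 0 < δ) (hμ : IsRootedHardCore δ μ) :
    rootEnergy lennardJones μ = 1 / 24 * (∫⁻ y, ENNReal.ofReal (‖y‖⁻¹ ^ 12) ∂μ).toReal -
      1 / 12 * (∫⁻ y, ENNReal.ofReal (‖y‖⁻¹ ^ 6) ∂μ).toReal := by
  have h := integral_lennardJones_dilate hδ hμ 1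
  simp only [one_mul, inv_one, one_pow, mul_one] at h
  rw [rootEnergy_def, h]
  ring

end Dilated

/-! ## §3. The dilation family of a law and its mean energies -/

section Law

variable {δ : ℝ} {P : Measure (Measure E3)}

/-- The shell moments are Giry-measurable, and integrable under a finite law almost surely carried by rooted `δ`-hard-core configurations
(bounded by the shell bounds). [folklore] -/
theorem integrable_moments (hδ : 0 < δ) [IsFiniteMeasure P] (hcore : ∀ᵐ μ ∂P, IsRootedHardCore δ μ) :
    Integrable (fun μ : Measure E3 => (∫⁻ y, ENNReal.ofReal (‖y‖⁻¹ ^ 6) ∂μ).toReal) P ∧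
      Integrable (fun μ : Measure E3 => (∫⁻ y, ENNReal.ofReal (‖y‖⁻¹ ^ 12) ∂μ).toReal) P := by
  constructor
  · refine Integrable.of_bound (Measure.measurable_lintegral (measurable_ofReal_invPow 6)).ennreal_toReal.aestronglyMeasurable
      (ENNReal.ofReal (250 * δ⁻¹ ^ 6)).toReal (hcore.mono fun μ hμ => ?_)
    rw [Real.norm_eq_abs, abs_of_nonneg ENNReal.toReal_nonneg]
    exact ENNReal.toReal_mono ENNReal.ofReal_ne_top (lintegral_invPow_le_of_isRootedHardCore hδ hμ).1
  · refine Integrable.of_bound (Measure.measurable_lintegral (measurable_ofReal_invPow 12)).ennreal_toReal.aestronglyMeasurable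
      (ENNReal.ofReal (250 * δ⁻¹ ^ 6 * δ⁻¹ ^ 6)).toReal (hcore.mono fun μ hμ => ?_)
    rw [Real.norm_eq_abs, abs_of_nonneg ENNReal.toReal_nonneg]
    exact ENNReal.toReal_mono ENNReal.ofReal_ne_top (lintegral_invPow_le_of_isRootedHardCore hδ hμ).2

/-- **Mean root energy of the `c`-dilated law**: `E_P[½ Σ_y V_LJ(c ‖y‖)] = (1/24) c⁻¹² E_P[I₁₂] − (1/12) c⁻⁶ E_P[I₆]`. [folklore] -/
theorem integral_dilatedEnergy (hδ : 0 < δ) [IsFiniteMeasure P] (hcore : ∀ᵐ μ ∂P, IsRootedHardCore δ μ) (c : ℝ) :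
    ∫ μ, (∫ y, lennardJones (c * ‖y‖) ∂μ) / 2 ∂P =
      1 / 24 * c⁻¹ ^ 12 * ∫ μ, (∫⁻ y, ENNReal.ofReal (‖y‖⁻¹ ^ 12) ∂μ).toReal ∂P -
        1 / 12 * c⁻¹ ^ 6 * ∫ μ, (∫⁻ y, ENNReal.ofReal (‖y‖⁻¹ ^ 6) ∂μ).toReal ∂P := by
  obtain ⟨hI6, hI12⟩ := integrable_moments hδ hcore
  have hae : ∀ᵐ μ ∂P, (∫ y, lennardJones (c * ‖y‖) ∂μ) / 2 =
      1 / 24 * c⁻¹ ^ 12 * (∫⁻ y, ENNReal.ofReal (‖y‖⁻¹ ^ 12) ∂μ).toReal -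
        1 / 12 * c⁻¹ ^ 6 * (∫⁻ y, ENNReal.ofReal (‖y‖⁻¹ ^ 6) ∂μ).toReal := by
    filter_upwards [hcore] with μ hμ
    rw [integral_lennardJones_dilate hδ hμ c]
    ring
  rw [integral_congr_ae hae, integral_sub (hI12.const_mul _) (hI6.const_mul _), integral_const_mul, integral_const_mul]

/-- **Mean root energy by shell moments**: `E_P[rootEnergy V_LJ] = (1/24) E_P[I₁₂] − (1/12) E_P[I₆]`. [folklore] -/
theorem integral_rootEnergy_eq_moments (hδ : 0 < δ) [IsFiniteMeasure P] (hcore : ∀ᵐ μ ∂P, IsRootedHardCore δ μ) :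
    ∫ μ, rootEnergy lennardJones μ ∂P =
      1 / 24 * ∫ μ, (∫⁻ y, ENNReal.ofReal (‖y‖⁻¹ ^ 12) ∂μ).toReal ∂P -
        1 / 12 * ∫ μ, (∫⁻ y, ENNReal.ofReal (‖y‖⁻¹ ^ 6) ∂μ).toReal ∂P := by
  obtain ⟨hI6, hI12⟩ := integrable_moments hδ hcore
  rw [integral_congr_ae (hcore.mono fun μ hμ => rootEnergy_eq_moments hδ hμ), integral_sub (hI12.const_mul _) (hI6.const_mul _),
    integral_const_mul, integral_const_mul]

/-- Double Bochner moments are the means of the `ℝ≥0∞` shell moments. [folklore] -/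
theorem integral_integral_invPow_eq (hδ : 0 < δ) (hcore : ∀ᵐ μ ∂P, IsRootedHardCore δ μ) :
    ∫ μ, ∫ y, ‖y‖⁻¹ ^ 6 ∂μ ∂P = ∫ μ, (∫⁻ y, ENNReal.ofReal (‖y‖⁻¹ ^ 6) ∂μ).toReal ∂P ∧
      ∫ μ, ∫ y, ‖y‖⁻¹ ^ 12 ∂μ ∂P = ∫ μ, (∫⁻ y, ENNReal.ofReal (‖y‖⁻¹ ^ 12) ∂μ).toReal ∂P :=
  ⟨integral_congr_ae (hcore.mono fun _ hμ => (integral_invPow_eq_toReal hδ hμ).1),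
    integral_congr_ae (hcore.mono fun _ hμ => (integral_invPow_eq_toReal hδ hμ).2)⟩

end Law

/-! ## §4. The virial identity of minimising laws -/

section Virial

variable {δ : ℝ} {P : Measure (Measure E3)}

/-- **VIRIAL IDENTITY OF MINIMISING LAWS.**  Granted the energy floor for point-stationary hard-core probability laws (item 9229, hypothesis
`hU`), every point-stationary `δ`-hard-core probability law `P` with `E_P[rootEnergy] ≤ e⋆` satisfies
`E_P[I₆] = E_P[I₁₂]`, `E_P[rootEnergy] = −(1/24) E_P[I₁₂]` and `E_P[rootEnergy] = e⋆`: the floor applied to the dilated laws `P_c` gives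
`e⋆ ≤ g(c) = (1/24) c⁻¹² E_P[I₁₂] − (1/12) c⁻⁶ E_P[I₆]` for all `c > 0` while `g(1) = E_P[rootEnergy] ≤ e⋆`, so `c = 1` is a minimum of `g`
and `g'(1) = −½ E_P[I₁₂] + ½ E_P[I₆] = 0` (Fermat). [folklore] -/
theorem virial_of_minimising
    (hU : ∀ δ' : ℝ, 0 < δ' → ∀ Q : Measure (Measure E3), IsProbabilityMeasure Q → (∀ᵐ μ ∂Q, IsRootedHardCore δ' μ) →
      IsPointStationaryLaw Q → eStar ≤ ∫ μ, rootEnergy lennardJones μ ∂Q)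
    (hδ : 0 < δ) [IsProbabilityMeasure P] (hcore : ∀ᵐ μ ∂P, IsRootedHardCore δ μ) (hstat : IsPointStationaryLaw P)
    (hmin : ∫ μ, rootEnergy lennardJones μ ∂P ≤ eStar) :
    ∫ μ, (∫⁻ y, ENNReal.ofReal (‖y‖⁻¹ ^ 6) ∂μ).toReal ∂P = ∫ μ, (∫⁻ y, ENNReal.ofReal (‖y‖⁻¹ ^ 12) ∂μ).toReal ∂P ∧
      ∫ μ, rootEnergy lennardJones μ ∂P = -(1 / 24) * ∫ μ, (∫⁻ y, ENNReal.ofReal (‖y‖⁻¹ ^ 12) ∂μ).toReal ∂P ∧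
      ∫ μ, rootEnergy lennardJones μ ∂P = eStar := by
  set M6 : ℝ := ∫ μ, (∫⁻ y, ENNReal.ofReal (‖y‖⁻¹ ^ 6) ∂μ).toReal ∂P with hM6
  set M12 : ℝ := ∫ μ, (∫⁻ y, ENNReal.ofReal (‖y‖⁻¹ ^ 12) ∂μ).toReal ∂P with hM12
  set g : ℝ → ℝ := fun c => 1 / 24 * c⁻¹ ^ 12 * M12 - 1 / 12 * c⁻¹ ^ 6 * M6 with hg
  -- the floor along the dilation family
  have hfloor : ∀ c : ℝ, 0 < c → eStar ≤ g c := by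
    intro c hc
    have h := eStar_le_integral_dilated hU hδ hcore hstat hc
    rwa [integral_dilatedEnergy hδ hcore c] at h
  -- the undilated value
  have hg1 : g 1 = ∫ μ, rootEnergy lennardJones μ ∂P := by
    rw [integral_rootEnergy_eq_moments hδ hcore]
    simp only [hg, inv_one, one_pow, mul_one]
    rfl
  -- `c = 1` is a (local) minimum of `g`
  have hlocmin : IsLocalMin g 1 := by
    refine Filter.eventually_of_mem (Ioi_mem_nhds one_pos) fun c hc => ?_
    rw [hg1]
    exact hmin.trans (hfloor c hc)
  -- Fermat
  have hderiv : HasDerivAt g (1 / 24 * ((12 : ℕ) * (1 : ℝ)⁻¹ ^ (12 - 1) * (-((1 : ℝ) ^ 2)⁻¹)) * M12 -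
      1 / 12 * ((6 : ℕ) * (1 : ℝ)⁻¹ ^ (6 - 1) * (-((1 : ℝ) ^ 2)⁻¹)) * M6) 1 := by
    have hinv : HasDerivAt (fun c : ℝ => c⁻¹) (-((1 : ℝ) ^ 2)⁻¹) 1 := hasDerivAt_inv one_ne_zero
    exact (((hinv.fun_pow 12).const_mul (1 / 24)).mul_const M12).sub (((hinv.fun_pow 6).const_mul (1 / 12)).mul_const M6)
  have hzero := hlocmin.hasDerivAt_eq_zero hderiv
  norm_num at hzero
  -- conclusions
  have hvir : M6 = M12 := by linarith
  have hE : ∫ μ, rootEnergy lennardJones μ ∂P = -(1 / 24) * M12 := by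
    rw [← hg1]
    simp only [hg, inv_one, one_pow, mul_one]
    rw [hvir]
    ring
  exact ⟨hvir, hE, le_antisymm hmin (by rw [← hg1]; exact hfloor 1 one_pos)⟩

/-- **Virial identity, Bochner form**: granted the floor, a point-stationary `δ`-hard-core probability law with `E_P[rootEnergy] ≤ e⋆` has
`∫∫ ‖y‖⁻⁶ dμ dP = ∫∫ ‖y‖⁻¹² dμ dP`, `E_P[rootEnergy] = −(1/24) ∫∫ ‖y‖⁻¹² dμ dP`, and `E_P[rootEnergy] = e⋆`. [folklore] -/
theorem virial_of_minimising'
    (hU : ∀ δ' : ℝ, 0 < δ' → ∀ Q : Measure (Measure E3), IsProbabilityMeasure Q → (∀ᵐ μ ∂Q, IsRootedHardCore δ' μ) →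
      IsPointStationaryLaw Q → eStar ≤ ∫ μ, rootEnergy lennardJones μ ∂Q)
    (hδ : 0 < δ) [IsProbabilityMeasure P] (hcore : ∀ᵐ μ ∂P, IsRootedHardCore δ μ) (hstat : IsPointStationaryLaw P)
    (hmin : ∫ μ, rootEnergy lennardJones μ ∂P ≤ eStar) :
    ∫ μ, ∫ y, ‖y‖⁻¹ ^ 6 ∂μ ∂P = ∫ μ, ∫ y, ‖y‖⁻¹ ^ 12 ∂μ ∂P ∧
      ∫ μ, rootEnergy lennardJones μ ∂P = -(1 / 24) * ∫ μ, ∫ y, ‖y‖⁻¹ ^ 12 ∂μ ∂P ∧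
      ∫ μ, rootEnergy lennardJones μ ∂P = eStar := by
  obtain ⟨h6, h12⟩ := integral_integral_invPow_eq hδ hcore
  obtain ⟨hvir, hE, heq⟩ := virial_of_minimising hU hδ hcore hstat hmin
  rw [h6, h12]
  exact ⟨hvir, hE, heq⟩

end Virial

end Summit.AtomisticToContinuum.Crystallization.Theorems.FrustratedLawDichotomyVirial

end
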